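import Literature.MathematicalPhysics.QuantumLattice.HubbardUVSymbolCTDifferences
import HarnessLib

/-!
# Matsubara sums of SHIFTED envelopes: `Σ_i max(|ω_i| - a·2π/β, Λ/2)^{-2n} ≤ 4ⁿ(2/Λ)^{2n-2}·2β/Λ + 4a·(2/Λ)^{2n}`, uniform in `M`

Topic `MathematicalPhysics/QuantumLattice`; companion of `HubbardUVSymbolCTDifferences` (cell gate-hubbard-kl).  An `a`-fold time difference
of a propagator symbol sampled at the `2M` truncated fermionic Matsubara frequencies `ω_i = π(2i+1-2M)/β` is controlled (iterated mean
value) by a derivative on the box `[ω_i, ω_i + a·2π/β]`, i.e. by the envelope `max(|ω|, Λ/2)` SHIFTED by `a` steps towards zero.  The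
`ℓ²` sums of such bounds are uniform in `M`: away from the `≤ 4a` central frequencies `|ω_i| < 4πa/β` the shifted envelope is at least
half the envelope (`Σ_i max(|ω_i|,Λ/2)^{-(2p+2)} ≤ (2/Λ)^{2p}·2β/Λ`, `sum_inv_uvEnv_pow_le`), at those it is at least `Λ/2`
(`HubbardUVSymbolCTDifferences.sum_inv_uvEnvShift_pow_six_le` is the case `a = 2`, `n = 3` with different constants).

* `card_centralFreq_le` — at most `4a` indices have `|ω_i| < 2·(a·2π/β)`;
* **`sum_inv_uvEnvShift_pow_le`**.

Everything is proved; no definitions, no named facts.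

## Sources

G. Benfatto, A. Giuliani, V. Mastropietro, Ann. Henri Poincaré 7 (2006) 809–898, §2.1 (2.2)–(2.5) (`BenfattoGiulianiMastropietro2006`);
M. Salmhofer, *Renormalization* (1999), §4.2.4 (4.63) (`Salmhofer1999`).
-/

noncomputable section

namespace Literature.MathematicalPhysics.QuantumLattice

open Literature.Probability.LatticeModels Literature.Analysis.SpecialFunctions Finset Complex

/-! ### Matsubara sums of the shifted envelopes -/

/-- **At most `4a` frequencies lie strictly within `4πa/β` of zero** (`|π(2i+1-2M)| < 4πa` forces `M - 2a ≤ i < M + 2a`).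
[cite: Salmhofer1999, §4.2.4 (4.63)] -/
theorem card_centralFreq_le {β : ℝ} (hβ : 0 < β) (M a : ℕ) :
    ((univ : Finset (MatsubaraIdx M)).filter fun i => |matsubaraFreq β M i| < 2 * (a * (2 * Real.pi / β))).card ≤ 4 * a := by
  classical
  set C := (univ : Finset (MatsubaraIdx M)).filter fun i => |matsubaraFreq β M i| < 2 * (a * (2 * Real.pi / β)) with hC
  have hinj : Set.InjOn (fun i : MatsubaraIdx M => (i : ℕ)) C := fun i _ i' _ h => Fin.ext h
  have hsub : C.image (fun i : MatsubaraIdx M => (i : ℕ)) ⊆ Finset.Ico (M - 2 * a) (M + 2 * a) := by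
    intro v hv
    obtain ⟨i, hi, rfl⟩ := mem_image.1 hv
    have h1 := (mem_filter.1 hi).2
    rw [matsubaraFreq, matsubaraInt, abs_div, abs_of_pos hβ, abs_mul, abs_of_pos Real.pi_pos,
      div_lt_iff₀ hβ] at h1
    have h2 : |(2 * (((i : ℕ) : ℤ) - M : ℤ) : ℝ) + 1| < 4 * a := by
      have h3 : Real.pi * |2 * ((((i : ℕ) : ℤ) - M : ℤ) : ℝ) + 1| < Real.pi * (4 * a) := by
        calc _ < 2 * (a * (2 * Real.pi / β)) * β := h1
          _ = Real.pi * (4 * a) := by field_simp; ring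
      exact lt_of_mul_lt_mul_left h3 Real.pi_pos.le
    push_cast at h2
    have hlt := i.isLt
    rw [Finset.mem_Ico]
    rcases abs_lt.1 h2 with ⟨h4, h5⟩
    constructor
    · by_contra hc
      have hc' := not_le.1 hc
      have : ((i : ℕ) : ℝ) + 1 ≤ (M : ℝ) - 2 * a := by
        have h6 : (i : ℕ) + 1 + 2 * a ≤ M := by omega
        have h7 : (((i : ℕ) + 1 + 2 * a : ℕ) : ℝ) ≤ (M : ℝ) := by exact_mod_cast h6
        push_cast at h7; linarith
      linarith
    · by_contra hc
      have hc' := not_lt.1 hc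
      have : (M : ℝ) + 2 * a ≤ ((i : ℕ) : ℝ) := by exact_mod_cast hc'
      linarith
  calc C.card = (C.image fun i : MatsubaraIdx M => (i : ℕ)).card := (card_image_of_injOn hinj).symm
    _ ≤ (Finset.Ico (M - 2 * a) (M + 2 * a)).card := card_le_card hsub
    _ ≤ 4 * a := by rw [Nat.card_Ico]; omega

/-- **`Σ_i max(|ω_i| - a·2π/β, Λ/2)^{-2n} ≤ 4ⁿ·(2/Λ)^{2n-2}·2β/Λ + 4a·(2/Λ)^{2n}`** (`0 < β`, `0 < Λ`, `1 ≤ n`): away from the `≤ 4a`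
central frequencies the shifted envelope is at least half the envelope; at those it is at least `Λ/2`.  Uniform in `M`.
[cite: BenfattoGiulianiMastropietro2006, §2.1 (2.2)–(2.5)] -/
theorem sum_inv_uvEnvShift_pow_le {β Λ : ℝ} (hβ : 0 < β) (hΛ : 0 < Λ) (M a : ℕ) {n : ℕ} (hn : 1 ≤ n) :
    ∑ i : MatsubaraIdx M, 1 / max (|matsubaraFreq β M i| - a * (2 * Real.pi / β)) (Λ / 2) ^ (2 * n) ≤
      4 ^ n * ((2 / Λ) ^ (2 * n - 2) * (2 * β / Λ)) + 4 * a * (2 / Λ) ^ (2 * n) := by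
  classical
  set s : ℝ := a * (2 * Real.pi / β) with hs
  have hs0 : 0 ≤ s := by positivity
  set C := (univ : Finset (MatsubaraIdx M)).filter fun i => |matsubaraFreq β M i| < 2 * s with hC
  -- pointwise split
  have hpt : ∀ i : MatsubaraIdx M, 1 / max (|matsubaraFreq β M i| - s) (Λ / 2) ^ (2 * n) ≤
      4 ^ n * (1 / max |matsubaraFreq β M i| (Λ / 2) ^ (2 * (n - 1) + 2)) + (if i ∈ C then (2 / Λ) ^ (2 * n) else 0) := by
    intro i
    set ω := matsubaraFreq β M i with hω
    have hm : 0 < max |ω| (Λ / 2) := uvEnv_pos hΛ ω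
    have hms : 0 < max (|ω| - s) (Λ / 2) := lt_max_of_lt_right (by positivity)
    have hexp : 2 * (n - 1) + 2 = 2 * n := by omega
    rw [hexp]
    by_cases hi : i ∈ C
    · rw [if_pos hi]
      refine le_add_of_nonneg_of_le ?_ ?_
      · positivity
      rw [show (2 / Λ) ^ (2 * n) = 1 / (Λ / 2) ^ (2 * n) by rw [one_div, ← inv_pow, inv_div]]
      exact one_div_le_one_div_of_le (pow_pos (by positivity) _) (pow_le_pow_left₀ (by positivity) (le_max_right _ _) _)
    · rw [if_neg hi, add_zero]
      have hfar : 2 * s ≤ |ω| := by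
        by_contra hcon
        exact hi (mem_filter.2 ⟨mem_univ _, not_le.1 hcon⟩)
      -- `max(|ω| - s, Λ/2) ≥ max(|ω|, Λ/2)/2`
      have hhalf : max |ω| (Λ / 2) / 2 ≤ max (|ω| - s) (Λ / 2) := by
        rw [div_le_iff₀ (by norm_num : (0 : ℝ) < 2)]
        refine max_le ?_ ?_
        · exact le_trans (by linarith) (mul_le_mul_of_nonneg_right (le_max_left _ _) (by norm_num))
        · exact le_trans (by linarith) (mul_le_mul_of_nonneg_right (le_max_right _ _) (by norm_num))
      calc 1 / max (|ω| - s) (Λ / 2) ^ (2 * n) ≤ 1 / (max |ω| (Λ / 2) / 2) ^ (2 * n) :=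
            div_le_div_of_nonneg_left zero_le_one (pow_pos (by positivity) _) (pow_le_pow_left₀ (by positivity) hhalf _)
        _ = 4 ^ n * (1 / max |ω| (Λ / 2) ^ (2 * n)) := by
            rw [div_pow, pow_mul (2 : ℝ) 2 n]; norm_num; field_simp
  refine (sum_le_sum fun i _ => hpt i).trans ?_
  rw [sum_add_distrib, ← mul_sum, ← sum_filter, Finset.filter_mem_eq_inter, Finset.univ_inter, sum_const, nsmul_eq_mul]
  have h2n : 2 * (n - 1) = 2 * n - 2 := by omega
  have h1 := (sum_inv_uvEnv_pow_le hβ hΛ M (n - 1)).trans (le_of_eq (by rw [h2n]))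
  have hcard : (C.card : ℝ) ≤ 4 * a := by exact_mod_cast card_centralFreq_le hβ M a
  exact add_le_add (mul_le_mul_of_nonneg_left h1 (by positivity)) (mul_le_mul_of_nonneg_right hcard (by positivity))

end Literature.MathematicalPhysics.QuantumLattice

end
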